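import Mathlib
import HarnessLib
import Literature.MathematicalPhysics.KineticTheory.HardSphereEulerProofs
import Literature.Analysis.FunctionSpaces.SpaceTimeLipschitz
import Literature.Analysis.FluidPDE.HardSpherePhaseSpaceProofs
import Summits.AtomisticToContinuum.HydrodynamicLimit.Theses.OneFlightGossipEngine
import Summits.AtomisticToContinuum.HydrodynamicLimit.Theorems.OneFlightGossipEngineKineticCurrentsWindowLDSplit

/-!
# Prelims of the s-axis net — stub `stub_sAxisNet` of line `Sketch`,
# crux `LocalClampedTransferLDAlongFamilies` (stmt-AtomisticToContinuum-17691)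

Route `OneFlightGossipEngine`, sub-problem `HydrodynamicLimit`. Generic statics used by the finite net in the
family parameter `s` that transfers the profile-wise collisional node `LCT♯` to the crux:

* §1 jointly smooth TEST families on the compact slab `[0,t₁] × 𝕋³`: smooth slices, uniform bounds of the first
  and second spatial derivatives, a transverse modulus of the first derivatives, and the MIXED time–space bound
  `|(φ_{s₁} − φ_{s₂})(x) − (φ_{s₁} − φ_{s₂})(x′)| ≤ K|s₁ − s₂|·d(x,x′)` (mean value theorem in time for
  `s ↦ φ_s x − φ_s x′`; `d` the minimal-image distance), which is what makes the transfer-CLAMPED collisional rows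
  Lipschitz along the family (at contact `d = ε_N`);
* §2 transverse moduli and slice continuity of fields that are only jointly CONTINUOUS on the slab (the EOS fields);
* §3 the one-body shape `p(x) + q(x)‖v − u(x)‖² + Σ_l r_l(x)(v − u(x))_l` of the EOS projections: a pointwise
  modulus `|g − g′| ≤ ω₁ + ω₂‖v‖²` from sup-closeness of the coefficient fields, and the centring modulus;
* §4 window bookkeeping on good orbits: sum/integral swap and the pricing of a pathwise bound
  `βD ≤ c + γ·(window energy)` by the exponential moment of the window energy.

References: S. Olla, S. R. S. Varadhan, H.-T. Yau, Comm. Math. Phys. 155 (1993) §2–3; H. Spohn, *Large Scale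
Dynamics of Interacting Particles* (1991), Part I §2.3.
-/

noncomputable section

open MeasureTheory Set Filter
open scoped ENNReal Topology BigOperators NNReal

namespace Summit.AtomisticToContinuum.HydrodynamicLimit.Theorems.LocalClampedTransferSketch

open Literature.Analysis.FluidPDE (HardSphereFlow Config configEnergy)
open Literature.MathematicalPhysics.KineticTheory (T3 V3)
open Literature.Analysis.FluidPDE Literature.MathematicalPhysics.KineticTheory Literature.Analysis.FunctionSpaces

/-! ### §1 Jointly smooth test families on `[0, t₁] × 𝕋³` -/

/-- **Joint Lipschitz bound on the compact slab** `[0,t₁] × 𝕋³` (`0 < t₁`): a field jointly smooth on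
`[0,t₁] × 𝕋³` satisfies `‖w s x − w s' x'‖ ≤ K (|s − s'| + d(x,x'))` with the minimal-image distance `d`
(`Torus.lipschitzOnWith_uncurry_of_bounds` for the product metric, whose torus factor is dominated by `d`);
the `Icc` twin of `HydroLimitInBandContinuity.exists_lipschitz_slab`. -/
theorem exists_lipschitz_slab_Icc {Y : Type*} [NormedAddCommGroup Y] [NormedSpace ℝ Y] {t₁ : ℝ}
    {w : ℝ → T3 → Y} (hw : Torus.IsSmoothSpaceTimeOn (Icc 0 t₁) w) (ht₁ : 0 < t₁) :
    ∃ K : ℝ, 0 ≤ K ∧ ∀ s ∈ Icc 0 t₁, ∀ s' ∈ Icc 0 t₁, ∀ x x' : T3,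
      ‖w s x - w s' x'‖ ≤ K * (|s - s'| + Torus.euclidDist x x') := by
  have hU : UniqueDiffOn ℝ (Icc (0 : ℝ) t₁) := uniqueDiffOn_Icc ht₁
  choose M hM using fun i : Fin 3 =>
    (hw.partialDeriv hU i).exists_norm_le_of_isCompact isCompact_Icc subset_rfl
  obtain ⟨B, hB⟩ := (hw.timeDerivWithin hU).exists_norm_le_of_isCompact isCompact_Icc subset_rfl
  have hL := Torus.lipschitzOnWith_uncurry_of_bounds hw (M := fun i => (M i).toNNReal)
    (fun i t ht x => (hM i t ht x).trans (Real.le_coe_toNNReal _)) (B := B.toNNReal)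
    (fun t ht x => (hB t ht x).trans (Real.le_coe_toNNReal _))
  set K : NNReal := NNReal.sqrt (Fintype.card (Fin 3)) * ∑ i, (M i).toNNReal + B.toNNReal
  refine ⟨K, K.2, fun s hs s' hs' x x' => ?_⟩
  have h := hL.dist_le_mul (s, x) ⟨hs, mem_univ _⟩ (s', x') ⟨hs', mem_univ _⟩
  simp only [Function.uncurry_apply_pair] at h
  rw [dist_eq_norm] at h
  refine h.trans (mul_le_mul_of_nonneg_left ?_ K.2)
  have hd0 : 0 ≤ Torus.euclidDist x x' := by rw [Torus.euclidDist_eq]; exact norm_nonneg _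
  rw [Prod.dist_eq, Real.dist_eq, dist_eq_norm]
  exact max_le (le_add_of_nonneg_right hd0)
    ((Torus.norm_sub_le_euclidDist_holds x x').trans (le_add_of_nonneg_left (abs_nonneg _)))

/-- **Mixed time–space bound** on `[0,t₁] × 𝕋³` (`0 < t₁`): for a scalar field jointly smooth on the slab,
`|(φ(s₁,x) − φ(s₁,x′)) − (φ(s₂,x) − φ(s₂,x′))| ≤ K |s₁ − s₂| d(x, x′)` — the mean value theorem in time for
`s ↦ φ(s,x) − φ(s,x′)`, whose one-sided derivative `∂ₛφ(s,x) − ∂ₛφ(s,x′)` is bounded by `K d(x,x′)` (joint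
Lipschitz bound of the jointly smooth field `∂ₛφ`); the `Icc` twin of `ClampedCurrentsDockFreezeToolkit.exists_mixed_lipschitz`. -/
theorem exists_mixed_lipschitz_Icc {t₁ : ℝ} {φ : ℝ → T3 → ℝ} (hφ : Torus.IsSmoothSpaceTimeOn (Icc 0 t₁) φ)
    (ht₁ : 0 < t₁) :
    ∃ K : ℝ, 0 ≤ K ∧ ∀ s₁ ∈ Icc 0 t₁, ∀ s₂ ∈ Icc 0 t₁, ∀ x x' : T3,
      |(φ s₁ x - φ s₁ x') - (φ s₂ x - φ s₂ x')| ≤ K * |s₁ - s₂| * Torus.euclidDist x x' := by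
  have hU : UniqueDiffOn ℝ (Icc (0 : ℝ) t₁) := uniqueDiffOn_Icc ht₁
  obtain ⟨K, hK, h⟩ := exists_lipschitz_slab_Icc (hφ.timeDerivWithin hU) ht₁
  refine ⟨K, hK, fun s₁ hs₁ s₂ hs₂ x x' => ?_⟩
  have hd : ∀ r ∈ Icc (0 : ℝ) t₁, HasDerivWithinAt (fun τ => φ τ x - φ τ x')
      (Torus.timeDerivWithin (Icc 0 t₁) φ r x - Torus.timeDerivWithin (Icc 0 t₁) φ r x') (Icc 0 t₁) r :=
    fun r hr => (hφ.hasDerivWithinAt_slice hr x).sub (hφ.hasDerivWithinAt_slice hr x')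
  have hb : ∀ r ∈ Icc (0 : ℝ) t₁, ‖Torus.timeDerivWithin (Icc 0 t₁) φ r x -
      Torus.timeDerivWithin (Icc 0 t₁) φ r x'‖ ≤ K * Torus.euclidDist x x' := fun r hr => by
    have h' := h r hr r hr x x'
    rwa [sub_self, abs_zero, zero_add] at h'
  have hm := (convex_Icc (0 : ℝ) t₁).norm_image_sub_le_of_norm_hasDerivWithin_le hd hb hs₂ hs₁
  rw [Real.norm_eq_abs, Real.norm_eq_abs] at hm
  calc |(φ s₁ x - φ s₁ x') - (φ s₂ x - φ s₂ x')| ≤ K * Torus.euclidDist x x' * |s₁ - s₂| := hm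
    _ = K * |s₁ - s₂| * Torus.euclidDist x x' := by ring

/-- A smooth function on the torus has bounded partial derivatives (continuity on a compact space). -/
theorem exists_abs_partialDeriv_le {ψ : T3 → ℝ} (hψ : Torus.IsSmooth ψ) :
    ∃ L : ℝ, 0 ≤ L ∧ (∀ (k : Fin 3) x, |Torus.partialDeriv k ψ x| ≤ L) ∧
      ∀ (k l : Fin 3) x, |Torus.partialDeriv k (Torus.partialDeriv l ψ) x| ≤ L := by
  have h1 : ∀ k : Fin 3, ∃ L : ℝ, ∀ x, |Torus.partialDeriv k ψ x| ≤ L := fun k => by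
    obtain ⟨L, hL⟩ := isCompact_univ.exists_bound_of_continuousOn
      ((hψ.partialDeriv k).continuous.continuousOn (s := univ))
    exact ⟨L, fun x => (Real.norm_eq_abs _).symm.le.trans (hL x (mem_univ x))⟩
  have h2 : ∀ k l : Fin 3, ∃ L : ℝ, ∀ x, |Torus.partialDeriv k (Torus.partialDeriv l ψ) x| ≤ L :=
    fun k l => by
    obtain ⟨L, hL⟩ := isCompact_univ.exists_bound_of_continuousOn
      (((hψ.partialDeriv l).partialDeriv k).continuous.continuousOn (s := univ))
    exact ⟨L, fun x => (Real.norm_eq_abs _).symm.le.trans (hL x (mem_univ x))⟩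
  choose L₁ hL₁ using h1
  choose L₂ hL₂ using h2
  refine ⟨(∑ k, |L₁ k|) + ∑ k, ∑ l, |L₂ k l|, by positivity, fun k x => ?_, fun k l x => ?_⟩
  · have hk : |L₁ k| ≤ ∑ k, |L₁ k| := Finset.single_le_sum (fun k _ => abs_nonneg (L₁ k)) (Finset.mem_univ k)
    exact ((hL₁ k x).trans (le_abs_self _)).trans (hk.trans (le_add_of_nonneg_right (by positivity)))
  · have hkl : |L₂ k l| ≤ ∑ k, ∑ l, |L₂ k l| :=
      (Finset.single_le_sum (fun l _ => abs_nonneg (L₂ k l)) (Finset.mem_univ l)).trans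
        (Finset.single_le_sum (fun k _ => Finset.sum_nonneg fun l _ => abs_nonneg (L₂ k l))
          (Finset.mem_univ k))
    exact ((hL₂ k l x).trans (le_abs_self _)).trans (hkl.trans (le_add_of_nonneg_left (by positivity)))

/-- **Uniform first- and second-derivative bounds of a jointly smooth test family** on `[0,t₁] × 𝕋³`: one constant
`Lφ ≥ 0` bounds `|∂ₖφ_s|` and `|∂ₖ∂ₗφ_s|` for all `s ∈ [0,t₁]` (for `t₁ > 0` the derivative families are jointly
smooth on the compact slab; for `t₁ = 0` the single slice is smooth; for `t₁ < 0` there is nothing to bound). -/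
theorem exists_testFamily_derivBounds {t₁ : ℝ} {φ : ℝ → T3 → ℝ} (hφ : Torus.IsSmoothSpaceTimeOn (Icc 0 t₁) φ) :
    ∃ Lφ : ℝ, 0 ≤ Lφ ∧ ∀ s ∈ Icc 0 t₁, Torus.IsSmooth (φ s) ∧
      (∀ (k : Fin 3) x, |Torus.partialDeriv k (φ s) x| ≤ Lφ) ∧
      ∀ (k l : Fin 3) x, |Torus.partialDeriv k (Torus.partialDeriv l (φ s)) x| ≤ Lφ := by
  rcases lt_trichotomy t₁ 0 with ht | rfl | ht
  · exact ⟨0, le_rfl, fun s hs => absurd (hs.1.trans hs.2) (not_le.2 ht)⟩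
  · obtain ⟨L, hL0, hL1, hL2⟩ := exists_abs_partialDeriv_le (hφ.isSmooth_slice (t := 0) ⟨le_rfl, le_rfl⟩)
    refine ⟨L, hL0, fun s hs => ?_⟩
    obtain rfl : s = 0 := le_antisymm hs.2 hs.1
    exact ⟨hφ.isSmooth_slice ⟨le_rfl, le_rfl⟩, hL1, hL2⟩
  · have hU : UniqueDiffOn ℝ (Icc (0 : ℝ) t₁) := uniqueDiffOn_Icc ht
    choose M₁ hM₁ using fun k : Fin 3 =>
      (hφ.partialDeriv hU k).exists_norm_le_of_isCompact isCompact_Icc subset_rfl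
    choose M₂ hM₂ using fun p : Fin 3 × Fin 3 =>
      ((hφ.partialDeriv hU p.2).partialDeriv hU p.1).exists_norm_le_of_isCompact isCompact_Icc subset_rfl
    refine ⟨(∑ k, |M₁ k|) + ∑ p, |M₂ p|, by positivity, fun s hs => ⟨hφ.isSmooth_slice hs, fun k x => ?_,
      fun k l x => ?_⟩⟩
    · have h := hM₁ k s hs x
      rw [Real.norm_eq_abs] at h
      have hk : |M₁ k| ≤ ∑ k, |M₁ k| := Finset.single_le_sum (fun k _ => abs_nonneg (M₁ k)) (Finset.mem_univ k)
      exact (h.trans (le_abs_self _)).trans (hk.trans (le_add_of_nonneg_right (by positivity)))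
    · have h := hM₂ (k, l) s hs x
      rw [Real.norm_eq_abs] at h
      have hkl : |M₂ (k, l)| ≤ ∑ p, |M₂ p| :=
        Finset.single_le_sum (fun p _ => abs_nonneg (M₂ p)) (Finset.mem_univ (k, l))
      exact (h.trans (le_abs_self _)).trans (hkl.trans (le_add_of_nonneg_left (by positivity)))

/-- **Mixed modulus of a jointly smooth test family** on `[0,t₁] × 𝕋³` (all `t₁`): one constant `K ≥ 0` with
`|(φ_{s₁} − φ_{s₂})(x) − (φ_{s₁} − φ_{s₂})(x′)| ≤ K|s₁ − s₂|·d(x,x′)` for `s₁, s₂ ∈ [0,t₁]`. -/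
theorem exists_testFamily_mixed {t₁ : ℝ} {φ : ℝ → T3 → ℝ} (hφ : Torus.IsSmoothSpaceTimeOn (Icc 0 t₁) φ) :
    ∃ K : ℝ, 0 ≤ K ∧ ∀ s₁ ∈ Icc 0 t₁, ∀ s₂ ∈ Icc 0 t₁, ∀ x x' : T3,
      |(φ s₁ x - φ s₁ x') - (φ s₂ x - φ s₂ x')| ≤ K * |s₁ - s₂| * Torus.euclidDist x x' := by
  rcases lt_or_ge 0 t₁ with ht | ht
  · exact exists_mixed_lipschitz_Icc hφ ht
  · refine ⟨0, le_rfl, fun s₁ hs₁ s₂ hs₂ x x' => ?_⟩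
    have h1 : s₁ = 0 := le_antisymm (hs₁.2.trans ht) hs₁.1
    have h2 : s₂ = 0 := le_antisymm (hs₂.2.trans ht) hs₂.1
    subst h1; subst h2
    simp

/-! ### §2 Fields jointly continuous on the slab -/

/-- **Transverse modulus of a field jointly continuous on the slab** `[0,t₁] × 𝕋³`: `dist (F(s,x)) (F(s',x)) < e`
once `s, s' ∈ [0,t₁]`, `|s − s'| ≤ δ(e)` (uniform continuity on the compact slab). -/
theorem exists_family_modulus_of_continuousOn {M : Type*} [PseudoMetricSpace M] (t₁ : ℝ) {F : ℝ × T3 → M}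
    (hF : ContinuousOn F (Icc 0 t₁ ×ˢ univ)) {e : ℝ} (he : 0 < e) :
    ∃ δ : ℝ, 0 < δ ∧ ∀ s ∈ Icc 0 t₁, ∀ s' ∈ Icc 0 t₁, |s - s'| ≤ δ →
      ∀ x : T3, dist (F (s, x)) (F (s', x)) < e := by
  have hK : IsCompact (Icc (0 : ℝ) t₁ ×ˢ (univ : Set T3)) := isCompact_Icc.prod isCompact_univ
  have hUC := hK.uniformContinuousOn_of_continuous hF
  rw [Metric.uniformContinuousOn_iff_le] at hUC
  obtain ⟨δ, hδ, h⟩ := hUC (e / 2) (half_pos he)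
  refine ⟨δ, hδ, fun s hs s' hs' hss' x => ?_⟩
  have hd : dist (s, x) (s', x) ≤ δ := by
    rw [Prod.dist_eq, dist_self, max_eq_left dist_nonneg, Real.dist_eq]; exact hss'
  calc dist (F (s, x)) (F (s', x)) ≤ e / 2 :=
        h (s, x) (Set.mk_mem_prod hs (mem_univ x)) (s', x) (Set.mk_mem_prod hs' (mem_univ x)) hd
    _ < e := half_lt_self he

/-- A field jointly continuous on the slab is bounded there. -/
theorem exists_bound_of_continuousOn (t₁ : ℝ) {F : ℝ × T3 → ℝ} (hF : ContinuousOn F (Icc 0 t₁ ×ˢ univ)) :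
    ∃ B : ℝ, 0 ≤ B ∧ ∀ s ∈ Icc 0 t₁, ∀ x : T3, |F (s, x)| ≤ B := by
  have hK : IsCompact (Icc (0 : ℝ) t₁ ×ˢ (univ : Set T3)) := isCompact_Icc.prod isCompact_univ
  obtain ⟨C, hC⟩ := hK.exists_bound_of_continuousOn hF
  exact ⟨max C 0, le_max_right _ _, fun s hs x =>
    ((Real.norm_eq_abs _).symm.le.trans (hC (s, x) (mk_mem_prod hs (mem_univ x)))).trans (le_max_left _ _)⟩

/-- Slices of a field jointly continuous on the slab are continuous. -/
theorem continuous_slice_of_continuousOn {M : Type*} [TopologicalSpace M] {t₁ : ℝ} {F : ℝ × T3 → M}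
    (hF : ContinuousOn F (Icc 0 t₁ ×ˢ univ)) {s : ℝ} (hs : s ∈ Icc 0 t₁) :
    Continuous fun x : T3 => F (s, x) := by
  have h : ContinuousOn (F ∘ fun x : T3 => (s, x)) univ :=
    hF.comp (by fun_prop) fun x _ => mk_mem_prod hs (mem_univ x)
  exact continuousOn_univ.1 h

/-- A jointly continuous field on `ℝ × 𝕋³` is jointly continuous on the slab (as an uncurried function). -/
theorem continuousOn_slab_of_continuous {M : Type*} [TopologicalSpace M] (t₁ : ℝ) {f : ℝ → T3 → M}
    (hf : Continuous (Function.uncurry f)) : ContinuousOn (fun p : ℝ × T3 => f p.1 p.2) (Icc 0 t₁ ×ˢ univ) :=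
  hf.continuousOn

/-! ### §3 The one-body shape of the EOS projections -/

/-- `|‖v − u′‖² − ‖v − u‖²| ≤ ‖u − u′‖ (2‖v‖ + ‖u‖ + ‖u′‖)`. -/
theorem abs_norm_sub_sq_sub_norm_sub_sq_le (v u u' : V3) :
    |‖v - u'‖ ^ 2 - ‖v - u‖ ^ 2| ≤ ‖u - u'‖ * (2 * ‖v‖ + ‖u‖ + ‖u'‖) := by
  have h1 : |‖v - u'‖ - ‖v - u‖| ≤ ‖u - u'‖ := by
    have := abs_norm_sub_norm_le (v - u') (v - u)
    rwa [show v - u' - (v - u) = u - u' by abel] at this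
  have h2 : ‖v - u'‖ + ‖v - u‖ ≤ 2 * ‖v‖ + ‖u‖ + ‖u'‖ := by
    have ha := norm_sub_le v u'
    have hb := norm_sub_le v u
    linarith
  rw [sq_sub_sq, abs_mul]
  calc |‖v - u'‖ + ‖v - u‖| * |‖v - u'‖ - ‖v - u‖|
      = (‖v - u'‖ + ‖v - u‖) * |‖v - u'‖ - ‖v - u‖| := by rw [abs_of_nonneg (by positivity)]
    _ ≤ (2 * ‖v‖ + ‖u‖ + ‖u'‖) * ‖u - u'‖ := mul_le_mul h2 h1 (abs_nonneg _) (by positivity)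
    _ = ‖u - u'‖ * (2 * ‖v‖ + ‖u‖ + ‖u'‖) := by ring

/-- **Pointwise modulus of the one-body shape** `g = p + q‖v − u‖² + Σ_l r_l (v − u)_l`: if the coefficients of `g`
and `g′` are close (`|p − p′| ≤ ωp`, `|q − q′| ≤ ωq`, `|r_l − r′_l| ≤ ωr`, `‖u − u′‖ ≤ ωu`) and bounded (`|q′| ≤ Q`,
`|r′_l| ≤ R`, `‖u‖, ‖u′‖ ≤ U`), then `|g − g′| ≤ ω₁ + ω₂‖v‖²` with
`ω₁ = ωp + 2ωqU² + Qωu(1 + 2U) + 3(ωr(1 + U) + Rωu)`, `ω₂ = 2ωq + Qωu + 3ωr` (all `→ 0` with the `ω`'s). -/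
theorem abs_shape_sub_le {p p' q q' ωp ωq ωr ωu Q R U : ℝ} {r r' : Fin 3 → ℝ} {u u' : V3}
    (hp : |p - p'| ≤ ωp) (hq : |q - q'| ≤ ωq) (hr : ∀ l, |r l - r' l| ≤ ωr) (hu : ‖u - u'‖ ≤ ωu)
    (hQ : |q'| ≤ Q) (hR : ∀ l, |r' l| ≤ R) (hU : ‖u‖ ≤ U) (hU' : ‖u'‖ ≤ U)
    (hωq : 0 ≤ ωq) (hωr : 0 ≤ ωr) (hωu : 0 ≤ ωu) (v : V3) :
    |(p + q * ‖v - u‖ ^ 2 + ∑ l, r l * (v - u) l) - (p' + q' * ‖v - u'‖ ^ 2 + ∑ l, r' l * (v - u') l)| ≤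
      (ωp + 2 * ωq * U ^ 2 + Q * ωu * (1 + 2 * U) + 3 * (ωr * (1 + U) + R * ωu)) +
        (2 * ωq + Q * ωu + 3 * ωr) * ‖v‖ ^ 2 := by
  have hQ0 : 0 ≤ Q := (abs_nonneg _).trans hQ
  have hR0 : 0 ≤ R := (abs_nonneg _).trans (hR 0)
  have hU0 : 0 ≤ U := (norm_nonneg _).trans hU
  have hv0 : 0 ≤ ‖v‖ := norm_nonneg v
  -- the quadratic part
  have hvu : ‖v - u‖ ^ 2 ≤ 2 * ‖v‖ ^ 2 + 2 * U ^ 2 := by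
    have h : ‖v - u‖ ≤ ‖v‖ + U := (norm_sub_le v u).trans (by linarith)
    nlinarith [norm_nonneg (v - u), sq_nonneg (‖v‖ - U)]
  have hA : |q * ‖v - u‖ ^ 2 - q' * ‖v - u'‖ ^ 2| ≤
      ωq * (2 * ‖v‖ ^ 2 + 2 * U ^ 2) + Q * (ωu * (2 * ‖v‖ + U + U)) := by
    have e : q * ‖v - u‖ ^ 2 - q' * ‖v - u'‖ ^ 2 =
        (q - q') * ‖v - u‖ ^ 2 - q' * (‖v - u'‖ ^ 2 - ‖v - u‖ ^ 2) := by ring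
    rw [e]
    refine (abs_sub _ _).trans (add_le_add ?_ ?_)
    · rw [abs_mul, abs_of_nonneg (by positivity : (0 : ℝ) ≤ ‖v - u‖ ^ 2)]
      exact mul_le_mul hq hvu (by positivity) hωq
    · rw [abs_mul]
      refine mul_le_mul hQ ((abs_norm_sub_sq_sub_norm_sub_sq_le v u u').trans ?_) (abs_nonneg _) hQ0
      exact mul_le_mul hu (by linarith) (by positivity) hωu
  -- the linear part, coordinatewise
  have hB : ∀ l, |r l * (v - u) l - r' l * (v - u') l| ≤ ωr * (‖v‖ + U) + R * ωu := by
    intro l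
    have e : r l * (v - u) l - r' l * (v - u') l = (r l - r' l) * (v - u) l + r' l * ((v - u) l - (v - u') l) := by
      ring
    have h1 : |(v - u) l| ≤ ‖v‖ + U := by
      have := PiLp.norm_apply_le (v - u) l
      rw [Real.norm_eq_abs] at this
      exact this.trans ((norm_sub_le v u).trans (by linarith))
    have h2 : |(v - u) l - (v - u') l| ≤ ωu := by
      have e2 : (v - u) l - (v - u') l = (u' - u) l := by simp [PiLp.sub_apply]
      rw [e2]
      have := PiLp.norm_apply_le (u' - u) l
      rw [Real.norm_eq_abs] at this
      exact this.trans (by rwa [norm_sub_rev])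
    rw [e]
    refine (abs_add_le _ _).trans (add_le_add ?_ ?_)
    · rw [abs_mul]; exact mul_le_mul (hr l) h1 (abs_nonneg _) hωr
    · rw [abs_mul]; exact mul_le_mul (hR l) h2 (abs_nonneg _) hR0
  have hB' : |∑ l, r l * (v - u) l - ∑ l, r' l * (v - u') l| ≤ 3 * (ωr * (‖v‖ + U) + R * ωu) := by
    rw [← Finset.sum_sub_distrib]
    refine (Finset.abs_sum_le_sum_abs _ _).trans ?_
    calc ∑ l : Fin 3, |r l * (v - u) l - r' l * (v - u') l| ≤ ∑ _l : Fin 3, (ωr * (‖v‖ + U) + R * ωu) :=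
          Finset.sum_le_sum fun l _ => hB l
      _ = 3 * (ωr * (‖v‖ + U) + R * ωu) := by simp [Finset.sum_const, Finset.card_univ, Fintype.card_fin]; ring
  have e : (p + q * ‖v - u‖ ^ 2 + ∑ l, r l * (v - u) l) - (p' + q' * ‖v - u'‖ ^ 2 + ∑ l, r' l * (v - u') l) =
      (p - p') + (q * ‖v - u‖ ^ 2 - q' * ‖v - u'‖ ^ 2) + (∑ l, r l * (v - u) l - ∑ l, r' l * (v - u') l) := by
    ring
  rw [e]
  refine ((abs_add_le _ _).trans (add_le_add ((abs_add_le _ _).trans (add_le_add hp hA)) hB')).trans ?_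
  -- `2‖v‖ ≤ 1 + ‖v‖²` and `‖v‖ ≤ 1 + ‖v‖²`
  have h2v : 2 * ‖v‖ ≤ 1 + ‖v‖ ^ 2 := by nlinarith [sq_nonneg (‖v‖ - 1)]
  have hlin : ‖v‖ ≤ 1 + ‖v‖ ^ 2 := by nlinarith [sq_nonneg (‖v‖ - 1)]
  have h1 : Q * ωu * (2 * ‖v‖) ≤ Q * ωu * (1 + ‖v‖ ^ 2) := mul_le_mul_of_nonneg_left h2v (mul_nonneg hQ0 hωu)
  have h2 : ωr * ‖v‖ ≤ ωr * (1 + ‖v‖ ^ 2) := mul_le_mul_of_nonneg_left hlin hωr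
  nlinarith [h1, h2]

/-- **Centring modulus**: if two integrands on the (probability) torus differ by at most `ω` pointwise and both are
integrable, their integrals differ by at most `ω`. -/
theorem abs_integral_sub_integral_le {f f' : T3 → ℝ} (hf : Integrable f) (hf' : Integrable f') {ω : ℝ}
    (h : ∀ x, |f x - f' x| ≤ ω) : |(∫ x, f x) - ∫ x, f' x| ≤ ω := by
  rw [← integral_sub hf hf']
  have h1 : ‖∫ x, (f x - f' x)‖ ≤ ω * (volume (univ : Set T3)).toReal := by
    refine norm_integral_le_of_norm_le_const ?_
    · exact Eventually.of_forall fun x => (Real.norm_eq_abs _).le.trans (h x)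
  rwa [measure_univ, ENNReal.toReal_one, mul_one, Real.norm_eq_abs] at h1

/-! ### §4 Window bookkeeping on good orbits -/

/-- **Sum/integral swap on a good orbit**: for a continuous one-body `G` and a good initial datum the window integral
of the particle sum is the particle sum of the window integrals. -/
theorem integral_sum_comp_orbit {ε : ℝ} {n : ℕ} (Φ : HardSphereFlow (Torus.geometry (Fin 3)) ε n)
    {z : Config n (Fin 3) T3} (hz : z ∈ Φ.good) {G : T3 × V3 → ℝ} (hG : Continuous G) (a b : ℝ) :
    ∫ r in a..b, ∑ i, G (Φ.flow r z i) = ∑ i, ∫ r in a..b, G (Φ.flow r z i) :=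
  intervalIntegral.integral_finsetSum fun i _ => intervalIntegrable_comp_orbit Φ hz hG i a b

/-- The window energy functional `Σᵢ w⁻¹∫₀ʷ ‖vᵢ(r)‖² dr` is nonnegative for `w > 0`. -/
theorem windowEnergy_nonneg {ε : ℝ} {n : ℕ} (Φ : HardSphereFlow (Torus.geometry (Fin 3)) ε n)
    (z : Config n (Fin 3) T3) {w : ℝ} (hw : 0 < w) :
    0 ≤ ∑ i, w⁻¹ * ∫ r in (0 : ℝ)..w, ‖(Φ.flow r z i).2‖ ^ 2 :=
  Finset.sum_nonneg fun _ _ => mul_nonneg (inv_pos.2 hw).le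
    (intervalIntegral.integral_nonneg hw.le fun _ _ => sq_nonneg _)

/-- **Pricing a pathwise bound by the window energy.** For a law `μ` carried by the good set and a functional `D`
with `β·D(z) ≤ c + γ′·W(z)` on good orbits, `W(z) = Σᵢ w⁻¹∫₀ʷ ‖vᵢ(r)‖² dr ≥ 0`, `γ′ ≤ γ`:
`∫ exp(βD) dμ ≤ e^{c} ∫ exp(γW) dμ`. -/
theorem lintegral_exp_le_of_pathwise_windowEnergy {ε : ℝ} {n : ℕ}
    (Φ : HardSphereFlow (Torus.geometry (Fin 3)) ε n) {μ : Measure (Config n (Fin 3) T3)}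
    (hμ : μ Φ.goodᶜ = 0) {D : Config n (Fin 3) T3 → ℝ} {β c γ' γ w : ℝ} (hw : 0 < w) (hγ : γ' ≤ γ)
    (hD : ∀ z ∈ Φ.good, β * D z ≤ c + γ' * ∑ i, w⁻¹ * ∫ r in (0 : ℝ)..w, ‖(Φ.flow r z i).2‖ ^ 2) :
    ∫⁻ z, ENNReal.ofReal (Real.exp (β * D z)) ∂μ ≤
      ENNReal.ofReal (Real.exp c) *
        ∫⁻ z, ENNReal.ofReal (Real.exp (γ * ∑ i, w⁻¹ * ∫ r in (0 : ℝ)..w, ‖(Φ.flow r z i).2‖ ^ 2)) ∂μ := by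
  have hgood : ∀ᵐ z ∂μ, z ∈ Φ.good :=
    measure_eq_zero_iff_ae_notMem.1 hμ |>.mono fun z hz => by simpa using hz
  refine (lintegral_mono_ae ?_).trans_eq (lintegral_const_mul' _ _ ENNReal.ofReal_ne_top)
  filter_upwards [hgood] with z hz
  rw [← ENNReal.ofReal_mul (Real.exp_nonneg _), ← Real.exp_add]
  refine ENNReal.ofReal_le_ofReal (Real.exp_le_exp.2 ((hD z hz).trans ?_))
  exact add_le_add le_rfl (mul_le_mul_of_nonneg_right hγ (windowEnergy_nonneg Φ z hw))

/-- **Cauchy–Schwarz split of a squared exponential functional** around a reference functional: for a.e.-measurable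
`exp(4βY)` and `exp(4β(Y′ − Y))`, `∫ (exp(βY′))² dμ ≤ (∫ exp(4βY) dμ)^{1/2} (∫ exp(4β(Y′ − Y)) dμ)^{1/2}`. -/
theorem lintegral_exp_sq_le_split {α : Type*} [MeasurableSpace α] {μ : Measure α} {Y Y' : α → ℝ} (β : ℝ)
    (hY : AEMeasurable (fun z => ENNReal.ofReal (Real.exp (4 * β * Y z))) μ)
    (hD : AEMeasurable (fun z => ENNReal.ofReal (Real.exp (4 * β * (Y' z - Y z)))) μ) :
    ∫⁻ z, ENNReal.ofReal (Real.exp (β * Y' z)) ^ 2 ∂μ ≤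
      (∫⁻ z, ENNReal.ofReal (Real.exp (4 * β * Y z)) ∂μ) ^ (1 / 2 : ℝ) *
        (∫⁻ z, ENNReal.ofReal (Real.exp (4 * β * (Y' z - Y z))) ∂μ) ^ (1 / 2 : ℝ) := by
  have hpq : (2 : ℝ).HolderConjugate 2 := Real.HolderConjugate.two_two
  set f : α → ℝ≥0∞ := fun z => ENNReal.ofReal (Real.exp (2 * β * Y z)) with hf
  set g : α → ℝ≥0∞ := fun z => ENNReal.ofReal (Real.exp (2 * β * (Y' z - Y z))) with hg
  have hsq : ∀ x : ℝ, ENNReal.ofReal (Real.exp x) ^ (2 : ℝ) = ENNReal.ofReal (Real.exp (2 * x)) := fun x => by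
    rw [ENNReal.ofReal_rpow_of_nonneg (Real.exp_pos _).le (by norm_num), ← Real.exp_mul, mul_comm]
  have hhalf : ∀ x : ℝ, ENNReal.ofReal (Real.exp (2 * x)) ^ (1 / (2 : ℝ)) = ENNReal.ofReal (Real.exp x) := fun x => by
    rw [ENNReal.ofReal_rpow_of_nonneg (Real.exp_pos _).le (by norm_num), ← Real.exp_mul]
    congr 1; ring
  have hfm : AEMeasurable f μ := by
    have h := hY.pow_const (1 / (2 : ℝ))
    refine h.congr (Eventually.of_forall fun z => ?_)
    simp only [hf]
    rw [show 4 * β * Y z = 2 * (2 * β * Y z) by ring, hhalf]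
  have hgm : AEMeasurable g μ := by
    have h := hD.pow_const (1 / (2 : ℝ))
    refine h.congr (Eventually.of_forall fun z => ?_)
    simp only [hg]
    rw [show 4 * β * (Y' z - Y z) = 2 * (2 * β * (Y' z - Y z)) by ring, hhalf]
  have hprod : ∀ z, ENNReal.ofReal (Real.exp (β * Y' z)) ^ 2 = (f * g) z := fun z => by
    simp only [hf, hg, Pi.mul_apply]
    rw [← ENNReal.ofReal_mul (Real.exp_nonneg _), ← Real.exp_add, ← ENNReal.ofReal_pow (Real.exp_nonneg _),
      ← Real.exp_nat_mul]
    congr 2; push_cast; ring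
  have hF2 : ∫⁻ z, f z ^ (2 : ℝ) ∂μ = ∫⁻ z, ENNReal.ofReal (Real.exp (4 * β * Y z)) ∂μ :=
    lintegral_congr fun z => by simp only [hf]; rw [hsq]; congr 2; ring
  have hG2 : ∫⁻ z, g z ^ (2 : ℝ) ∂μ = ∫⁻ z, ENNReal.ofReal (Real.exp (4 * β * (Y' z - Y z))) ∂μ :=
    lintegral_congr fun z => by simp only [hg]; rw [hsq]; congr 2; ring
  calc ∫⁻ z, ENNReal.ofReal (Real.exp (β * Y' z)) ^ 2 ∂μ = ∫⁻ z, (f * g) z ∂μ := lintegral_congr hprod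
    _ ≤ (∫⁻ z, f z ^ (2 : ℝ) ∂μ) ^ (1 / (2 : ℝ)) * (∫⁻ z, g z ^ (2 : ℝ) ∂μ) ^ (1 / (2 : ℝ)) :=
        ENNReal.lintegral_mul_le_Lp_mul_Lq μ hpq hfm hgm
    _ = (∫⁻ z, ENNReal.ofReal (Real.exp (4 * β * Y z)) ∂μ) ^ (1 / 2 : ℝ) *
        (∫⁻ z, ENNReal.ofReal (Real.exp (4 * β * (Y' z - Y z))) ∂μ) ^ (1 / 2 : ℝ) := by
        rw [hF2, hG2]

/-- **Registered prelim of stub `stub_sAxisNet`** (line `Sketch`, crux `LocalClampedTransferLDAlongFamilies`): the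
mixed modulus of a jointly smooth test family on `[0,t₁] × 𝕋³` — the Lipschitz constant, across a contact, of the
difference `φ_{s₁} − φ_{s₂}` of two members of the test family is `≤ K|s₁ − s₂|`, which (with the transfer clamp)
makes the clamped collisional rows Lipschitz along the family. -/
theorem stub_sAxisNetPrelim :
    ∀ (t₁ : ℝ) (φ : ℝ → T3 → ℝ), Torus.IsSmoothSpaceTimeOn (Set.Icc 0 t₁) φ →
      ∃ K : ℝ, 0 ≤ K ∧ ∀ s₁ ∈ Set.Icc 0 t₁, ∀ s₂ ∈ Set.Icc 0 t₁, ∀ x x' : T3,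
        |(φ s₁ x - φ s₁ x') - (φ s₂ x - φ s₂ x')| ≤ K * |s₁ - s₂| * Torus.euclidDist x x' :=
  fun _ _ hφ => exists_testFamily_mixed hφ

end Summit.AtomisticToContinuum.HydrodynamicLimit.Theorems.LocalClampedTransferSketch

end
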